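import Summits.QuantumFields.YangMills.Theorems.BalabanLadderIRScalingHeredity
import Summits.QuantumFields.YangMills.Theorems.IR.Negative.ColdExitAtVacuityThreshold
import Summits.QuantumFields.YangMills.Theorems.DoublingDefectRecursionToGapSpectral
import Literature.MathematicalPhysics.QuantumLattice.GaugeGroupsProofs
import HarnessLib

/-!
# `CofinalExitAt θ` (K1, = `ExitsUnboundedAt θ` of the cofinal bill `IRcof`) is DECIDED by the kernel outside `[0,1)`

Negative-lane calibration of the K1 family of the re-typed infinite-volume rung (director-ym R423, 2026-08-28: the gap is owed only
along an unbounded set of couplings; bill `K1 ∧ X ∧ N`, K1 = `ExitsUnboundedAt (1/24)`, landed verbatim twin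
`ScalingHeredity.CofinalExitAt`).  Companion of `Theorems/IR/Negative/ColdExitAtVacuityThreshold.lean` and
`Theorems/IR/Negative/ColdExitAtNegativeToleranceFalse.lean` (the one-box seed `E(θ) = BasinRung.ColdExitAt θ`).

* `cofinalExitAt_of_one_le` — `1 ≤ θ → CofinalExitAt θ`: trivially true (`δᶜ < 1` always; via `E(θ) → K1(θ)`,
  `ScalingHeredity.cofinal_of_coldExitAt`).
* `not_cofinalExitAt_of_neg` — `SimplyConnectedSpace SU(2) → θ < 0 → ¬ CofinalExitAt θ`: at `SU(2)` and `β₁ = 0` the posited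
  exit coupling `β ≥ 0` would carry a cold torus with `δᶜ ≤ θ < 0`, contradicting trace positivity
  (`DoublingDefect.coldDefect_nonneg`).  The `π₁` hypothesis is PROVED in the tree
  (`Theorems.BrascampLiebVacuumSC.Negative.simplyConnectedSpace_su2`) and is carried here only to keep this module outside that
  file's Theses cone.
* `not_coldExitAt_of_not_cofinalExitAt` — contrapositive bookkeeping: any refutation of K1(θ) refutes E(θ).

So the registered tolerance `θ = 1/24` lies in the contentful window `[0,1)`, where `¬ K1(θ)` reads: for some `(G, r, β₁)`, EVERY cold
`4:1` torus of EVERY size `L ≥ 8` is more than `θ`-impure at EVERY `β ≥ β₁` — the quantifier swap (`β₁` before `L`) of the per-box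
femto statement `EventualImpurityAt r θ` (`Theorems/ColdExitSC/Negative/UniformExitFalseOfFemtoTowerRep.lean`), i.e. an
infinite-volume non-confinement statement for a simply-connected group; no kernel construction of it is known (typed-kill lineage
ym-19354-disprove-1, memo §23.10).  Nothing here proves or refutes K1(1/24), `IR`, or any summit conjunct.
-/

noncomputable section

open Literature.MathematicalPhysics.QuantumFieldTheory
open Summit.QuantumFields.YangMills.Cruxes.IR.ColdPurityBridge (coldDefect)
open Summit.QuantumFields.YangMills.Cruxes.IR.BasinRung (ColdExitAt)
open Summit.QuantumFields.YangMills.Cruxes.IR.ScalingHeredity (CofinalExitAt cofinal_of_coldExitAt)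

namespace Summit.QuantumFields.YangMills.Cruxes.IR.ScalingHeredity.Negative

/-- **K1(θ) is trivially true for `θ ≥ 1`** (`δᶜ < 1` at every `β, L`). [folklore] -/
theorem cofinalExitAt_of_one_le {θ : ℝ} (hθ : 1 ≤ θ) : CofinalExitAt θ :=
  cofinal_of_coldExitAt (BasinRung.Negative.coldExitAt_of_one_le hθ)

/-- **K1(θ) is false for `θ < 0`** (witness `SU(2)`, any lattice representation, `β₁ = 0`; `δᶜ ≥ 0` at `β ≥ 0`). [folklore] -/
theorem not_cofinalExitAt_of_neg (hsc : SimplyConnectedSpace (Matrix.specialUnitaryGroup (Fin 2) ℂ)) {θ : ℝ}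
    (hθ : θ < 0) : ¬ CofinalExitAt θ := by
  intro h
  have hSU : IsCompactSimpleLieGroup (Matrix.specialUnitaryGroup (Fin 2) ℂ) :=
    isCompactSimpleLieGroup_specialUnitaryGroup
      Literature.MathematicalPhysics.QuantumLattice.isSimpleCompactGroup_specialUnitaryGroup_holds le_rfl
  obtain ⟨r⟩ := hSU.2
  letI : MeasurableSpace (Matrix.specialUnitaryGroup (Fin 2) ℂ) := borel _
  haveI : BorelSpace (Matrix.specialUnitaryGroup (Fin 2) ℂ) := ⟨rfl⟩
  obtain ⟨β, hβ0, L, hL, hdef⟩ := h (Matrix.specialUnitaryGroup (Fin 2) ℂ) hSU hsc r 0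
  haveI : NeZero L := ⟨by omega⟩
  haveI : SecondCountableTopology (Matrix.specialUnitaryGroup (Fin 2) ℂ) :=
    (r.continuous.isClosedEmbedding r.injective).isEmbedding.secondCountableTopology
  have hnn : 0 ≤ coldDefect r.ρ β L := by
    unfold coldDefect
    exact Summit.QuantumFields.YangMills.Theorems.DoublingDefect.coldDefect_nonneg r.continuous r.mem_unitary
      hβ0 L (L / 4) (by omega)
  linarith

/-- Bookkeeping: a refutation of K1(θ) refutes the one-box seed E(θ) (contrapositive of `cofinal_of_coldExitAt`). -/
theorem not_coldExitAt_of_not_cofinalExitAt {θ : ℝ} (h : ¬ CofinalExitAt θ) : ¬ ColdExitAt θ :=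
  fun hE => h (cofinal_of_coldExitAt hE)

end Summit.QuantumFields.YangMills.Cruxes.IR.ScalingHeredity.Negative

end
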